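import Mathlib
import Summits.ValiantsHypothesis.ValiantsHypothesis.Theorems.ClassTransfer.Negative.OddPowFree

/-!
# Crux `ClassTransfer` (stmt-ValiantsHypothesis-7287), negative side — tools:
# block-cyclic permutation sums on `Fin r × ι` and odd powers of a three-block cyclic map

Lead prover of line `registered`.  Companion of `Negative/BlockSums.lean` (the two-block,
antidiagonal case behind `T ∈ VP ⇒ VP = VNP`) for `r` blocks arranged in a cycle, used at `r = 3`
by `Negative/EvenCycleDetPerHard.lean` (the even-cycle determinant is permanent-hard).  Pure
Mathlib, no definitions; the cyclic lift of block maps `α : Fin r → Perm ι` is written inline as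
`(Equiv.prodCongrRight α).trans (Equiv.prodCongrLeft fun _ => Equiv.addRight 1)`,
i.e. `(k, i) ↦ (k + 1, α k i)`.

* `sum_perm_blockCyclic` — if the entry pattern `E row col` vanishes unless `row` lies in the
  block after `col`'s, then `Σ_σ W(σ) ∏_x E(σ x, x)` only sees cyclic lifts, and the product splits
  into the `r` blocks;
* `sign_blockCyclic`, `sign_addRight_one_fin_three`, `sign_blockCyclic_three` — the sign of a lift
  (`r = 3`: the block rotation is even, so `sgn = sgn(α₂α₁α₀)`);
* `blockCyclic_three_pow_three(_mul)`, `blockCyclic_pow_fst` — `L³ (k, i) = (k, α_{k+2}α_{k+1}α_k i)`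
  and the block coordinate of `Lⁿ x` is `x.1 + n`;
* `oddPowFree_blockCyclic_three_iff` — **a three-block lift is free of odd-power fixed points iff
  the composite `α₂α₁α₀` is** (cycle lengths triple; the three block composites are conjugate).

[folklore]
-/

set_option linter.dupNamespace false

noncomputable section

namespace Summit.ValiantsHypothesis.ValiantsHypothesis.Theorems.ClassTransfer.Negative

open Equiv Finset
open scoped Fin.NatCast

/-- **Block-cyclic permutation sums.**  On `Fin r × ι` (blocks indexed by `Fin r`), if the entry
pattern `E row col` vanishes unless `row` lies in the block after `col`'s, then in
`Σ_σ W(σ) ∏_x E(σ x, x)` only the cyclic block maps `(k, i) ↦ (k + 1, α k i)`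
(`α : Fin r → Perm ι`) survive, and the product splits into the `r` blocks. [folklore] -/
theorem sum_perm_blockCyclic {r : ℕ} [NeZero r] {ι : Type*} [Fintype ι] [DecidableEq ι]
    {S : Type*} [CommRing S] (W : Perm (Fin r × ι) → S) (E : (Fin r × ι) → (Fin r × ι) → S)
    (hE : ∀ (k k' : Fin r) (i i' : ι), k' ≠ k + 1 → E (k', i') (k, i) = 0) :
    ∑ σ : Perm (Fin r × ι), W σ * ∏ x, E (σ x) x =
      ∑ α : Fin r → Perm ι,
        W ((Equiv.prodCongrRight α).trans (Equiv.prodCongrLeft fun _ : ι => Equiv.addRight (1 : Fin r))) *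
          ∏ k : Fin r, ∏ i : ι, E (k + 1, α k i) (k, i) := by
  classical
  set Φ : (Fin r → Perm ι) → Perm (Fin r × ι) := fun α =>
    (Equiv.prodCongrRight α).trans (Equiv.prodCongrLeft fun _ : ι => Equiv.addRight (1 : Fin r))
    with hΦ
  have hΦapp : ∀ (α : Fin r → Perm ι) (k : Fin r) (i : ι), Φ α (k, i) = (k + 1, α k i) := by
    intro α k i; simp [hΦ]
  have hΦinj : Function.Injective Φ := by
    intro α α' h
    funext k
    refine Equiv.ext fun i => ?_
    have := congrArg (fun σ : Perm (Fin r × ι) => (σ (k, i)).2) h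
    simpa [hΦapp] using this
  -- the right-hand side is the sum over the image of `Φ`
  have hrhs : ∑ α : Fin r → Perm ι, W (Φ α) * ∏ k : Fin r, ∏ i : ι, E (k + 1, α k i) (k, i) =
      ∑ σ ∈ (univ : Finset (Fin r → Perm ι)).map ⟨Φ, hΦinj⟩, W σ * ∏ x, E (σ x) x := by
    rw [Finset.sum_map]
    refine Finset.sum_congr rfl fun α _ => ?_
    simp only [Function.Embedding.coeFn_mk]
    rw [Fintype.prod_prod_type]
    simp only [hΦapp]
  rw [hrhs]
  symm
  refine Finset.sum_subset (Finset.subset_univ _) fun σ _ hσ => ?_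
  -- a permutation outside the image has an entry off the cyclic block pattern
  by_cases hcyc : ∀ x : Fin r × ι, (σ x).1 = x.1 + 1
  · exfalso
    apply hσ
    -- build the block maps
    have hinj : ∀ k : Fin r, Function.Injective fun i : ι => (σ (k, i)).2 := by
      intro k i j hij
      have h1 : σ (k, i) = σ (k, j) := Prod.ext (by rw [hcyc, hcyc]) hij
      simpa using σ.injective h1
    set α : Fin r → Perm ι := fun k =>
      Equiv.ofBijective (fun i : ι => (σ (k, i)).2) (hinj k).bijective_of_finite with hα
    rw [Finset.mem_map]
    refine ⟨α, Finset.mem_univ _, ?_⟩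
    simp only [Function.Embedding.coeFn_mk]
    refine Equiv.ext fun x => ?_
    obtain ⟨k, i⟩ := x
    rw [hΦapp]
    exact Prod.ext (hcyc (k, i)).symm (by simp [hα])
  · push Not at hcyc
    obtain ⟨⟨k, i⟩, hk⟩ := hcyc
    rw [Finset.prod_eq_zero (Finset.mem_univ (k, i)), mul_zero]
    have : σ (k, i) = ((σ (k, i)).1, (σ (k, i)).2) := rfl
    rw [this]
    exact hE k _ i _ hk

/-- The sign of a cyclic block map: `sgn((k, i) ↦ (k+1, α k i)) = sgn(k ↦ k+1)^{#ι} · ∏_k sgn(α k)`.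
[folklore] -/
theorem sign_blockCyclic {r : ℕ} [NeZero r] {ι : Type*} [Fintype ι] [DecidableEq ι]
    (α : Fin r → Perm ι) :
    Perm.sign ((Equiv.prodCongrRight α).trans
        (Equiv.prodCongrLeft fun _ : ι => Equiv.addRight (1 : Fin r))) =
      Perm.sign (Equiv.addRight (1 : Fin r)) ^ Fintype.card ι * ∏ k, Perm.sign (α k) := by
  rw [← Perm.mul_def, Perm.sign_mul, Perm.sign_prodCongrLeft, Perm.sign_prodCongrRight,
    Finset.prod_const, Finset.card_univ]
  congr

/-- The block rotation `k ↦ k + 1` of `Fin 3` is an even permutation. [folklore] -/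
theorem sign_addRight_one_fin_three : Perm.sign (Equiv.addRight (1 : Fin 3)) = 1 := by
  decide

/-- The sign of a cyclic three-block map is the sign of its composite block map. [folklore] -/
theorem sign_blockCyclic_three {ι : Type*} [Fintype ι] [DecidableEq ι] (α : Fin 3 → Perm ι) :
    Perm.sign ((Equiv.prodCongrRight α).trans
        (Equiv.prodCongrLeft fun _ : ι => Equiv.addRight (1 : Fin 3))) =
      Perm.sign (α 2 * α 1 * α 0) := by
  rw [← Perm.mul_def, Perm.sign_mul, Perm.sign_prodCongrLeft, Perm.sign_prodCongrRight,
    Fin.prod_univ_three, Perm.sign_mul, Perm.sign_mul]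
  simp only [sign_addRight_one_fin_three, Finset.prod_const_one, one_mul]
  ac_rfl


/-- The cube of a cyclic three-block map is block-diagonal:
`L³ (k, i) = (k, (α (k+2) α (k+1) α k) i)`. [folklore] -/
theorem blockCyclic_three_pow_three {ι : Type*} (α : Fin 3 → Perm ι) (k : Fin 3) (i : ι) :
    (((Equiv.prodCongrRight α).trans (Equiv.prodCongrLeft fun _ : ι => Equiv.addRight (1 : Fin 3))) ^ 3)
        (k, i) = (k, (α (k + 2) * α (k + 1) * α k) i) := by
  have happ : ∀ (k : Fin 3) (i : ι),
      ((Equiv.prodCongrRight α).trans (Equiv.prodCongrLeft fun _ : ι => Equiv.addRight (1 : Fin 3)))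
        (k, i) = (k + 1, α k i) := by
    intro k i; simp
  rw [pow_succ, pow_two, Perm.mul_apply, Perm.mul_apply, happ, happ, happ]
  refine Prod.ext ?_ ?_
  · show k + 1 + 1 + 1 = k
    have : (1 : Fin 3) + 1 + 1 = 0 := by decide
    rw [add_assoc, add_assoc, ← add_assoc (1 : Fin 3), this, add_zero]
  · show α (k + 1 + 1) (α (k + 1) (α k i)) = (α (k + 2) * α (k + 1) * α k) i
    rw [Perm.mul_apply, Perm.mul_apply, add_assoc]
    rfl

/-- Iterating: `L^{3t} (k, i) = (k, (α (k+2) α (k+1) α k)^t i)`. [folklore] -/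
theorem blockCyclic_three_pow_three_mul {ι : Type*} (α : Fin 3 → Perm ι) (k : Fin 3) (i : ι)
    (t : ℕ) :
    (((Equiv.prodCongrRight α).trans (Equiv.prodCongrLeft fun _ : ι => Equiv.addRight (1 : Fin 3))) ^
        (3 * t)) (k, i) = (k, ((α (k + 2) * α (k + 1) * α k) ^ t) i) := by
  induction t generalizing i with
  | zero => simp
  | succ t ih =>
    rw [Nat.mul_succ, pow_add, Perm.mul_apply, blockCyclic_three_pow_three, ih, pow_succ]
    simp only [Perm.mul_apply]

/-- The block coordinate advances by one at each step: `(L^n x).1 = x.1 + n`. [folklore] -/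
theorem blockCyclic_pow_fst {r : ℕ} [NeZero r] {ι : Type*} (α : Fin r → Perm ι) (n : ℕ)
    (x : Fin r × ι) :
    ((((Equiv.prodCongrRight α).trans
        (Equiv.prodCongrLeft fun _ : ι => Equiv.addRight (1 : Fin r))) ^ n) x).1 =
      x.1 + (n : Fin r) := by
  have hstep : ∀ y : Fin r × ι, (((Equiv.prodCongrRight α).trans
      (Equiv.prodCongrLeft fun _ : ι => Equiv.addRight (1 : Fin r))) y).1 = y.1 + 1 := by
    rintro ⟨k, i⟩; simp
  induction n with
  | zero => simp
  | succ n ih =>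
    rw [pow_succ', Perm.mul_apply, hstep, ih, Nat.cast_succ, add_assoc]

/-- **A three-block cyclic map is free of odd-power fixed points iff the composite block map
`α 2 α 1 α 0` is.** (Cycle lengths triple under the lift.) [folklore] -/
theorem oddPowFree_blockCyclic_three_iff {ι : Type*} (α : Fin 3 → Perm ι) :
    (∀ (x : Fin 3 × ι) (j : ℕ),
      (((Equiv.prodCongrRight α).trans
        (Equiv.prodCongrLeft fun _ : ι => Equiv.addRight (1 : Fin 3))) ^ (2 * j + 1)) x ≠ x) ↔
      ∀ (i : ι) (j : ℕ), ((α 2 * α 1 * α 0) ^ (2 * j + 1)) i ≠ i := by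
  set L := (Equiv.prodCongrRight α).trans
    (Equiv.prodCongrLeft fun _ : ι => Equiv.addRight (1 : Fin 3)) with hL
  constructor
  · intro h i j hi
    apply h ((0 : Fin 3), i) (3 * j + 1)
    have h3 : 2 * (3 * j + 1) + 1 = 3 * (2 * j + 1) := by ring
    rw [h3, hL, blockCyclic_three_pow_three_mul]
    simpa using hi
  · intro h x j hx
    obtain ⟨k, i⟩ := x
    -- the exponent is a multiple of three
    have hfst := blockCyclic_pow_fst α (2 * j + 1) (k, i)
    rw [← hL, hx] at hfst
    have h3 : (3 : ℕ) ∣ 2 * j + 1 := by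
      have : ((2 * j + 1 : ℕ) : Fin 3) = 0 := by
        have := hfst.symm
        rwa [add_eq_left] at this
      exact Fin.natCast_eq_zero.1 this
    obtain ⟨t, ht⟩ := h3
    obtain ⟨s, rfl⟩ : ∃ s, t = 2 * s + 1 := ⟨t / 2, by omega⟩
    rw [ht, hL, blockCyclic_three_pow_three_mul] at hx
    have hx' : ((α (k + 2) * α (k + 1) * α k) ^ (2 * s + 1)) i = i := (Prod.ext_iff.1 hx).2
    -- each block composite is a conjugate of `α 2 α 1 α 0`
    have hk3 : ∀ k' : Fin 3, k' = 0 ∨ k' = 1 ∨ k' = 2 := by decide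
    have hk := hk3 k
    rcases hk with rfl | rfl | rfl
    · have e1 : (0 : Fin 3) + 2 = 2 := by decide
      have e2 : (0 : Fin 3) + 1 = 1 := by decide
      rw [e1, e2] at hx'
      exact h i s hx'
    · have hc : α ((1 : Fin 3) + 2) * α ((1 : Fin 3) + 1) * α 1 =
          α 0 * (α 2 * α 1 * α 0) * (α 0)⁻¹ := by
        have e1 : (1 : Fin 3) + 2 = 0 := by decide
        have e2 : (1 : Fin 3) + 1 = 2 := by decide
        rw [e1, e2]; group
      rw [hc] at hx'
      exact (oddPowFree_conj_iff (α 0) (α 2 * α 1 * α 0)).2 h i s hx'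
    · have hc : α ((2 : Fin 3) + 2) * α ((2 : Fin 3) + 1) * α 2 =
          (α 1 * α 0) * (α 2 * α 1 * α 0) * (α 1 * α 0)⁻¹ := by
        have e1 : (2 : Fin 3) + 2 = 1 := by decide
        have e2 : (2 : Fin 3) + 1 = 0 := by decide
        rw [e1, e2]; group
      rw [hc] at hx'
      exact (oddPowFree_conj_iff (α 1 * α 0) (α 2 * α 1 * α 0)).2 h i s hx'

end Summit.ValiantsHypothesis.ValiantsHypothesis.Theorems.ClassTransfer.Negative
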